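import Summits.QuantumAdvantage.QuantumAdvantage.Theorems.SoloInformedFloorRandomOracle
import Summits.QuantumAdvantage.QuantumAdvantage.Theorems.SoloInformedSummitRandomOracle
import Literature.Barriers.QuantumAdvantage.RelativizationProofs
import HarnessLib

/-!
# The summit's shape relative to a random oracle: a.e. true granted the summit, collapse only on null sets

Solo seat `solo-QuantumAdvantage-informed`, session 7, file 23 (closing corollaries of files 20 and 22).

With Bennett–Gill `BPP^A = P^A` a.e. (file 20, `ae_BPPRel_eq_PRel`) the `P^A`-statements of file 22
transfer to `BPP^A`, the class in the summit's own shape `Φ O := ∃ L ∈ BQP^O, L ∉ BPP^O`: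

* `BQP_eq_BPP_of_collapse_on_nonNull : (¬ ∀ᵐ A, ¬ BQP^A ⊆ BPP^A) → BQP = BPP` — a collapse
  `BQP^A ⊆ BPP^A` on a NON-NULL set of oracles already collapses the real world (Fortnow–Rogers 4.4
  from positive measure, `BPP^A` form);
* `ae_exists_BQPRel_not_mem_BPPRel_of_quantumAdvantage : QuantumAdvantage → ∀ᵐ A, ∃ L ∈ BQP^A, L ∉ BPP^A`
  and `aeRelativizes_summitShape_of_quantumAdvantage` — GRANTED THE SUMMIT, its shape holds relative to
  almost every oracle (for every presentation of `BQP^·`), although it does not relativize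
  (`Relativization_holds`: it fails at the collapsing oracle) — `summitShape_measure_vs_oracle`;
* `not_aeRelativizes_collapseShape_of_quantumAdvantage` — and the negation's shape `BQP^O ⊆ BPP^O` is
  then not even almost-everywhere true.

The converse descent `(∀ᵐ A, BQP^A ⊄ BPP^A) → QuantumAdvantage` is the random-oracle hypothesis for
this shape and is NOT claimed (tree `Literature.Barriers.QuantumAdvantage.RandomOracleMethod`).

## References
* [BennettGill1981] C. H. Bennett, J. Gill, SIAM J. Comput. 10 (1981), Thm. 5; via Book–Vollmer–Wagner, ICALP 1996, §4 Thm. 3.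
* [FortnowRogers1999JCSS] L. Fortnow, J. Rogers, JCSS 59 (1999), Thm. 4.4 and §5 (arXiv:cs/9811023 numbering).
* [BernsteinVazirani1997SICOMP] E. Bernstein, U. Vazirani, SIAM J. Comput. 26 (1997), Thm. 8.4, Cor. 8.14.
-/

noncomputable section

namespace Summit.QuantumAdvantage.QuantumAdvantage.Theorems

open _root_.MeasureTheory _root_.Computability Literature.Computability.Complexity
  Literature.Computability.Complexity.Classes Literature.Computability.Cryptography
  Literature.Computability.QuantumComplexity Literature.Barriers.PneNP Literature.Barriers.QuantumAdvantage

/-- **A collapse on a non-null set of oracles collapses the real world**: if `BQP^A ⊆ BPP^A` does not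
fail almost surely, then `BQP = BPP`. (`BPP^A = P^A` a.e. transfers the non-null set to `P^A`;
then file 22's `BQP_eq_BPP_of_not_ae_ne`.) [cite: FortnowRogers1999JCSS, Thm. 4.4 (arXiv numbering)] [cite: BennettGill1981, Thm. 5] -/
theorem BQP_eq_BPP_of_collapse_on_nonNull
    (h : ¬ ∀ᵐ A : Set (List Bool) ∂randomOracleMeasure,
      ¬ BQPRel (A : Language Bool) ⊆ BPPRel (Oracle.ofLanguage A)) :
    BQP = BPP := by
  refine BQP_eq_BPP_of_not_ae_ne fun hne => h ?_
  filter_upwards [hne, ae_BPPRel_eq_PRel] with A hA heq hsub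
  exact hA (Set.Subset.antisymm (heq ▸ PRel_subset_BPPRel_holds _ |>.trans
    (PRel_ofLanguage_subset_BQPRel_holds A)) (heq ▸ hsub))

/-- **Granted the summit, its own language separates `BQP^A` from `BPP^A` for almost every `A`.**
[cite: FortnowRogers1999JCSS, Thm. 4.4 (arXiv numbering)] [cite: BennettGill1981, Thm. 5] -/
theorem ae_exists_BQPRel_not_mem_BPPRel_of_quantumAdvantage (hS : QuantumAdvantage) :
    ∀ᵐ A : Set (List Bool) ∂randomOracleMeasure,
      ∃ L ∈ BQPRel (A : Language Bool), L ∉ BPPRel (Oracle.ofLanguage A) := by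
  filter_upwards [ae_exists_BQPRel_not_mem_PRel_of_quantumAdvantage hS, ae_BPPRel_eq_PRel] with A hA heq
  obtain ⟨L, hL, hnL⟩ := hA
  exact ⟨L, hL, heq ▸ hnL⟩

/-- Granted the summit, `BQP^A ⊄ BPP^A` almost surely. [cite: FortnowRogers1999JCSS, Thm. 4.4 (arXiv numbering)] -/
theorem ae_not_BQPRel_subset_BPPRel_of_quantumAdvantage (hS : QuantumAdvantage) :
    ∀ᵐ A : Set (List Bool) ∂randomOracleMeasure,
      ¬ BQPRel (A : Language Bool) ⊆ BPPRel (Oracle.ofLanguage A) := by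
  filter_upwards [ae_exists_BQPRel_not_mem_BPPRel_of_quantumAdvantage hS] with A hA h
  obtain ⟨L, hL, hnL⟩ := hA
  exact hnL (h hL)

/-- **Granted the summit, the summit's shape holds relative to almost every oracle**, for every
presentation `C` of `BQP^·`. [cite: FortnowRogers1999JCSS, Thm. 4.4 (arXiv numbering)] [cite: BennettGill1981, Thm. 1] -/
theorem aeRelativizes_summitShape_of_quantumAdvantage (hS : QuantumAdvantage)
    {C : Oracle → Set (Language Bool)} (hC : PresentsBQPRel C) :
    AERelativizes fun O => ∃ L ∈ C O, L ∉ BPPRel O := by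
  change ∀ᵐ A : Set (List Bool) ∂randomOracleMeasure,
    ∃ L ∈ C (Oracle.ofLanguage A), L ∉ BPPRel (Oracle.ofLanguage A)
  filter_upwards [ae_exists_BQPRel_not_mem_BPPRel_of_quantumAdvantage hS] with A hA
  rw [hC A]
  exact hA

/-- Granted the summit, the negation's shape `BQP^O ⊆ BPP^O` is not almost-everywhere true (indeed
almost-everywhere false). [cite: FortnowRogers1999JCSS, Thm. 4.4 (arXiv numbering)] -/
theorem not_aeRelativizes_collapseShape_of_quantumAdvantage (hS : QuantumAdvantage)
    {C : Oracle → Set (Language Bool)} (hC : PresentsBQPRel C) :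
    ¬ AERelativizes fun O => C O ⊆ BPPRel O := fun h =>
  (aeRelativizes_summitShape_of_quantumAdvantage hS hC).not_aeRelativizes_not
    (h.mono fun O (hO : C O ⊆ BPPRel O) (hex : ∃ L ∈ C O, L ∉ BPPRel O) =>
      let ⟨_, hL, hnL⟩ := hex
      hnL (hO hL))

/-- **Measure versus specific oracles for the summit's own shape.** Granted the summit,
`Φ O := ∃ L ∈ BQP^O, L ∉ BPP^O` holds for almost every oracle; unconditionally neither `Φ` nor `¬ Φ`
relativizes (collapsing and separating oracles, `Relativization_holds`). So a proof of the summit is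
a proof of a non-relativizing statement that is nevertheless random-oracle-true — the exact profile
of `IP = PSPACE`'s negation-free cousin, and no help: random-oracle truth does not descend.
[cite: FortnowRogers1999JCSS, Thm. 4.4 and §5 (arXiv numbering)] [cite: BernsteinVazirani1997SICOMP, Thm. 8.4 and Cor. 8.14] -/
theorem summitShape_measure_vs_oracle (hS : QuantumAdvantage)
    {C : Oracle → Set (Language Bool)} (hC : PresentsBQPRel C) :
    (AERelativizes fun O => ∃ L ∈ C O, L ∉ BPPRel O) ∧
      (¬ Relativizes fun O => ∃ L ∈ C O, L ∉ BPPRel O) ∧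
        ¬ Relativizes fun O => C O ⊆ BPPRel O :=
  ⟨aeRelativizes_summitShape_of_quantumAdvantage hS hC,
    Relativization_holds.not_relativizes_summit_shape hC,
    Relativization_holds.not_relativizes_collapse_shape hC⟩

/-- Summary of the oracle axis for the language classes, granted nothing: collapse on a non-null set
of oracles ⇒ `BQP = BPP`; the summit ⇒ separation almost everywhere; contrary oracles both ways.
[cite: FortnowRogers1999JCSS, Thm. 4.4 (arXiv numbering)] -/
theorem languageClasses_oracleAxis :
    ((¬ ∀ᵐ A : Set (List Bool) ∂randomOracleMeasure,
        ¬ BQPRel (A : Language Bool) ⊆ BPPRel (Oracle.ofLanguage A)) → BQP = BPP) ∧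
      (QuantumAdvantage → ∀ᵐ A : Set (List Bool) ∂randomOracleMeasure,
        ¬ BQPRel (A : Language Bool) ⊆ BPPRel (Oracle.ofLanguage A)) ∧
      (∃ A B : Language Bool,
        BQPRel A ⊆ BPPRel (Oracle.ofLanguage A) ∧ ¬ BQPRel B ⊆ BPPRel (Oracle.ofLanguage B)) :=
  ⟨BQP_eq_BPP_of_collapse_on_nonNull, ae_not_BQPRel_subset_BPPRel_of_quantumAdvantage, Relativization_holds⟩

end Summit.QuantumAdvantage.QuantumAdvantage.Theorems

end
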